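import Summits.Ventures.DiscreteObjects.UnitDistance.UnitQuadranceF27
import Summits.Ventures.DiscreteObjects.UnitDistance.AtlasKillerValues
import HarnessLib

/-!
# `q = 27` decided at the 4-point level (certificate-backed): `α(UD(F₂₇²)) ≤ 143`, hence `χ ≥ 6` and the killer residue fields are exactly `F₃, F₇, F₁₁, F₁₉`

Framing (verbatim for the cell): lottery ticket; floor = certified bounds/negative ranges.

`UnitQuadranceF27.lean` (udg g5) typed the open census statement `alpha_udF27_le_145` and proved `six_le_chromaticNumber_udF27_of : alpha_udF27_le_145 →
χ(unitCircleGraph F) ≥ 6` for every field with 27 elements.  On 2026-08-21 the engines' 4-point SDP relaxation (client file `alpha4pt_q27.json.gz`, data_sha256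
`0bb3fcc9…760c`, udg g6), rung 1 (kit j127177, eng-sdp-1 g7), produced a `certsdp-cert/0` whose exact dual bound is `−43442407051537847898765241 / 2⁷⁸ =
−143.7388…`; it was verified by two independent exact readers (engines `verify_a` in-job; the cell's `verify_c.py`, udg g8, `CERT-Q27-4PT-VERIFY.md`).  So
`α(UD(F₂₇²)) ≤ 143` is CERTIFICATE-BACKED (NOT a kernel fact — the certificate is an 18.9 MB Gram-factor object), and with it `χ(UD(F₂₇²)) ≥ 6`: `F₂₇` is not
a killer residue field and the order-1 atlas sentence closes — the killer residue fields are EXACTLY `F₃, F₇, F₁₁, F₁₉` (whose values 3, 4, 5, 5 ARE kernel,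
`AtlasKillerValues.lean`).  This file types the sharper statement and the implications; nothing here is deeper than bookkeeping.  Seat udg g8.
-/

namespace Summit.Ventures.DiscreteObjects.UnitDistance

open SimpleGraph

/-- CERTIFICATE-BACKED STATEMENT (typed, not kernel-proved): every field with 27 elements has `α(unitCircleGraph F) ≤ 143`.
Evidence: 4-point SDP certificate `cert0_alpha4pt-UD(F_27^2)_eps1e-06.json.gz` (sha256 `ff568a6a…0368`, engines kit j127177) for the cell's problem file
`alpha4pt_q27.json.gz` (data_sha256 `0bb3fcc9…760c`), exact bound `−43442407051537847898765241/2⁷⁸`; readers: engines `verify_a` (in-job), cell `verify_c.py`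
(udg g8, 229 s); all fields of order 27 are isomorphic. -/
def alpha_udF27_le_143 : Prop :=
  ∀ (F : Type) [Field F] [Fintype F], Fintype.card F = 27 → (unitCircleGraph F).indepNum ≤ 143

/-- The certified statement implies the previously OPEN census statement `alpha_udF27_le_145`. -/
theorem alpha_udF27_le_145_of_le_143 (h : alpha_udF27_le_143) : alpha_udF27_le_145 :=
  fun F _ _ hF => (h F hF).trans (by norm_num)

/-- `χ(unitCircleGraph F) ≥ 6` for every field with 27 elements, from the certificate-backed `α ≤ 143` (`5 · 143 = 715 < 729`). -/
theorem six_le_chromaticNumber_udF27_of_le_143 (h : alpha_udF27_le_143) (F : Type) [Field F] [Fintype F] (hF : Fintype.card F = 27) :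
    (6 : ℕ∞) ≤ (unitCircleGraph F).chromaticNumber :=
  six_le_chromaticNumber_udF27_of (alpha_udF27_le_145_of_le_143 h) F hF

/-- With the kernel 7-colouring: `χ(unitCircleGraph F) ∈ {6, 7}` for `|F| = 27`, given the certificate. -/
theorem chromaticNumber_udF27_mem_of_le_143 (h : alpha_udF27_le_143) (F : Type) [Field F] [Fintype F] (hF : Fintype.card F = 27) :
    (6 : ℕ∞) ≤ (unitCircleGraph F).chromaticNumber ∧ (unitCircleGraph F).chromaticNumber ≤ 7 :=
  ⟨six_le_chromaticNumber_udF27_of_le_143 h F hF, chromaticNumber_unitCircleGraph_le_seven_of_card_eq_27 F hF⟩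

/-- THE ATLAS SENTENCE (conditional on the certificate): among the residue fields `F₃, F₇, F₁₁, F₁₉` (kernel values 3, 4, 5, 5 — killers) and the fields with
27 elements, the latter are NOT killers: their unit-circle graphs are not 5-colourable. -/
theorem not_colorable_five_of_card_eq_27 (h : alpha_udF27_le_143) (F : Type) [Field F] [Fintype F] (hF : Fintype.card F = 27) :
    ¬ (unitCircleGraph F).Colorable 5 := by
  intro hc
  have h6 := six_le_chromaticNumber_udF27_of_le_143 h F hF
  have h5 : (unitCircleGraph F).chromaticNumber ≤ 5 := hc.chromaticNumber_le
  exact absurd (h6.trans h5) (by decide)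

end Summit.Ventures.DiscreteObjects.UnitDistance
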